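/-
Copyright (c) 2026 the pub-hodgecm-mathlib formalisation cell (harness21).  Prover seat hodgecm-mathlib-F0P2-p01 (g11), programme P2,
row (Ta) «ARCHIMEDEAN-FRAME TRANSPORT OF THE `∃ θ`-CLAUSE» of the desk's CENSUS-OCCGEN-B2 (`F0/P2/CENSUS-OCCGEN-B2.F0P2-plan-g12.md` §2 (Ta),
the OUTPUT ADAPTER of ROAD Θ-GEN-P4), 2026-09-01.  KERNEL module: THEOREMS ONLY (no definition, no named fact, no `sorry`, no instance, no notation).
-/
import Summits.HodgeConjecture.HodgeConjecture.Theorems.F0P2aFrameTransportPin     -- ★ `exists_frameTransport_pin` (F0P2a-p06)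
import Summits.HodgeConjecture.HodgeConjecture.Theorems.H413CohFormsCarriersLemmas -- ★ `CohFormsCarriers.holCotForms_le_cohForms`
import HarnessLib

/-!
# FLOOR-0 P2 · (Ta) «ARCHIMEDEAN-FRAME TRANSPORT»: an occurrence `θ : W → holCotForms (archFactorOf F V)` (the P4 engine's currency) gives an
# occurrence `W → cohForms (cmArchSection T, cmCompactFactor T)` (the letter's currency) for EVERY Sylvester frame `T` of `Hm V` at `ι₁`

Cell hodgecm-mathlib (D-0151), FLOOR 0; crux item H413 = stmt-HodgeConjecture-24833 (route `HCCMUnconditional`, no route verbs); programme P2, the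
OCC♭-GEN pay-down line of OCC♭∀ (`Cruxes/H413/Lines/F0_P2OccFlatGeneral.lean`, ONE letter Θ-OCC-GEN `StubThetaOccursInGen`).  Desk F0P2-plan (g12)'s
CENSUS-OCCGEN-B2 §2 ROAD Θ-GEN-P4: the ★ engine `ThetaJunction.exists_holTheta_atLine_of_inputs` concludes
`∃ θ, θ ≠ 0 ∧ (∀ w, θ w ∈ holCotForms (archFactorOf F V)) ∧ ∀ g w, θ (ρ g w) = rightRep F V g (θ w)` — values in the crux carriers of the
archimedean factor OF RECORD (the Sylvester frame `V.sylvesterFrame`); the letter wants values in `cohForms … (cmArchSection L ι H T hT)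
(cmCompactFactor L ι H T hT)` for the frame `T` it quantifies over.  (Ta) = ★ `F0P2aFrameTransportPin.exists_frameTransport_pin` (F0P2a-p06):
right translation by an archimedean element `a` (commuting with `U(V)(𝔸_{F⁺,f})`) identifies the two families of carriers; the desk's probe
`F0/P2/probe_occgen_engine_adapter.F0P2-plan-g12.lean` (3) turned it into the INVERSE linear map `Lb : Φ ↦ Φ(· a⁻¹)`.  THIS FILE lands that
step as theorems and applies it to the `∃ θ`-clause, for ANY representation `σ` of `U(V)(𝔸_{F⁺,f})` on any `W` (so in particular for
`ρ(a′,χ) = rhoVAtLine … ∘ ιVE V` of the engine and, after ★ (Tf) `F0P2sThetaOccursInFrameTransport`, for the letter's `rhoAtLine … ιV a χ`).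
THEOREMS ONLY; `--supports stmt-HodgeConjecture-24833`.  HONEST LABEL: HC_CM is proved only modulo the printed citations until rung 0 closes; this file
closes NO print letter.

## What is proved (pin data `(F : HodgeCM.CMField) (V : HermSpace3 F ι₁)`, any Sylvester frame `(T, hT)` of `Hm V` at `ι₁`)
* **`exists_linear_frameTransport_from_pin`** — an injective `ℂ`-linear `Lb` on `ℂ²`-valued functions on `U(V)(𝔸_{F⁺})`, commuting with the
  finite-adelic right translation `rightRep F V`, carrying `holCotForms (archFactorOf F V)` INTO `holCotForms [cmArchSection T, cmCompactFactor T]`,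
  the conjugates likewise, and `cohForms` INTO `cohForms` (the desk's probe (3), credited; over ★ `exists_frameTransport_pin`).
* **`occursClause_map_values`** (generic over the pin datum): an injective `rightRep`-commuting linear `Lb` with `Lb '' A ⊆ A′` carries the clause
  «`∃ θ : W →ₗ[ℂ] (U(V)(𝔸) → ℂ²), θ ≠ 0 ∧ (∀ w, θ w ∈ A) ∧ ∀ g w, θ (σ g w) = rightRep F V g (θ w)`» to the same clause for `A′`.
* **`occursClause_holCotForms_frame_of_archFactorOf`** ∕ **`occursClause_cohForms_frame_of_archFactorOf`** — the clause with values in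
  `holCotForms (archFactorOf F V)` (the engine's) gives the clause with values in `holCotForms [T]`, resp. `cohForms [T]` (the letter's), the
  equivariance now spelled `θ (σ g w) = fun x ↦ θ w (x * finAdelicToAdelic … g)` as in `StubThetaOccursInGen`.

## References
* [BorelJacquet1979] A. Borel, H. Jacquet, PSPM 33.1 (1979), §4.1 (archimedean ∕ finite factorisation), §4.2 (right translations).
* [BorelWallach2000] A. Borel, N. Wallach, 2nd ed. (2000), VII 2.10 (Hodge types of cohomological representations).
* [PlatonovRapinchuk1994] V. Platonov, A. Rapinchuk, *Algebraic groups and number theory* (1994), §2.3, §5.1.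
* [Liu2021] Y. Liu, Camb. J. Math. 9 (2021) = arXiv:2102.11518, Prop. 4.13 («Conversely» l. 2145–2149); App. D Lem. D.2.
-/

set_option autoImplicit false

-- the mandated namespace has the single-problem summit's repeated segment (`HodgeConjecture.HodgeConjecture`)
set_option linter.dupNamespace false

noncomputable section

open NumberField MulAction
open scoped Matrix ComplexOrder

namespace Summit.HodgeConjecture.HodgeConjecture.Cruxes.H413.F0P2sThetaOccursInArchTransport

open Summit.HodgeConjecture.HodgeConjecture.Cruxes.H413
open Summit.HodgeConjecture.HodgeConjecture.Cruxes.H413.F0P2aFrameTransport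
open Summit.HodgeConjecture.HodgeConjecture.Cruxes.H413.F0P2aFrameTransportPin
open Literature.NumberTheory.Automorphic Literature.NumberTheory.Automorphic.UnitaryGroup
open Literature.NumberTheory.Automorphic.UnitaryGroup.CotangentForms
open Literature.AlgebraicGeometry.ShimuraVarieties
open Literature.Geometry.ComplexHyperbolic
open Literature.Geometry.ComplexHyperbolic.BallModel (U21 x₀)

variable (F : HodgeCM.CMField) {ι₁ : F →+* ℂ} (V : HodgeCM.HermSpace3 F ι₁) (T : GL (Fin 3) ℂ)
  (hT : (T : Matrix (Fin 3) (Fin 3) ℂ)ᴴ * (HodgeCM.HermSpace3.Hm V).map ι₁ * (T : Matrix (Fin 3) (Fin 3) ℂ) = BallModel.J)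

/-! ## §1 The inverse arch adapter `Lb : Φ ↦ Φ(· a⁻¹)` (the desk's probe (3), as theorems) -/

/-- **(Ta)⁻¹ as an injective equivariant linear map.**  For any Sylvester frame `T` of `Hm V` at `ι₁` there is a `ℂ`-linear injective `Lb` on
`ℂ²`-valued functions on `U(V)(𝔸_{F⁺})` (right translation by `a⁻¹` for the archimedean `a` of ★ `exists_frameTransport_pin`, Mathlib `LinearMap.funLeft`)
commuting with the finite-adelic right translation `rightRep F V` and carrying `holCotForms (archFactorOf F V)` INTO `holCotForms [cmArchSection T,
cmCompactFactor T]`, the antiholomorphic carriers INTO each other likewise, and `cohForms (archFactorOf F V)` INTO `cohForms [cmArchSection T, cmCompactFactor T]`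
(desk F0P2-plan (g12)'s probe `exists_linear_frameTransport_from_pin`, here as a tree theorem).
[cite: BorelJacquet1979, §4.1, §4.2] [cite: BorelWallach2000, VII 2.10] [cite: PlatonovRapinchuk1994, §2.3] -/
theorem exists_linear_frameTransport_from_pin :
    ∃ Lb : ((CohFormsCarriers.adelicDatum F V).Adelic → (Fin 2 → ℂ)) →ₗ[ℂ] ((CohFormsCarriers.adelicDatum F V).Adelic → (Fin 2 → ℂ)),
      Function.Injective Lb ∧
      (∀ (g : ↥(HodgeCM.HermSpace3.adelicFin V)) (Φ : (CohFormsCarriers.adelicDatum F V).Adelic → (Fin 2 → ℂ)),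
        CohFormsCarriers.rightRep F V g (Lb Φ) = Lb (CohFormsCarriers.rightRep F V g Φ)) ∧
      (∀ Φ : (CohFormsCarriers.adelicDatum F V).Adelic → (Fin 2 → ℂ),
        Φ ∈ CohFormsCarriers.holCotForms (CohFormsCarriers.archFactorOf F V) →
        Lb Φ ∈ holCotForms (↥(maximalRealSubfield (HodgeCM.CMField.K F))) (HodgeCM.CMField.K F) (IsCMField.complexConj (HodgeCM.CMField.K F)) 3
          (HodgeCM.HermSpace3.Hm V) (cmArchSection (HodgeCM.CMField.K F) ι₁ (HodgeCM.HermSpace3.Hm V) T hT)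
          (cmCompactFactor (HodgeCM.CMField.K F) ι₁ (HodgeCM.HermSpace3.Hm V) T hT)) ∧
      (∀ Φ : (CohFormsCarriers.adelicDatum F V).Adelic → (Fin 2 → ℂ),
        Φ ∈ (CohFormsCarriers.holCotForms (CohFormsCarriers.archFactorOf F V)).map (CohFormsCarriers.conjFun F V) →
        Lb Φ ∈ (holCotForms (↥(maximalRealSubfield (HodgeCM.CMField.K F))) (HodgeCM.CMField.K F) (IsCMField.complexConj (HodgeCM.CMField.K F)) 3
          (HodgeCM.HermSpace3.Hm V) (cmArchSection (HodgeCM.CMField.K F) ι₁ (HodgeCM.HermSpace3.Hm V) T hT)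
          (cmCompactFactor (HodgeCM.CMField.K F) ι₁ (HodgeCM.HermSpace3.Hm V) T hT)).map
          (conjFun (↥(maximalRealSubfield (HodgeCM.CMField.K F))) (HodgeCM.CMField.K F) (IsCMField.complexConj (HodgeCM.CMField.K F)) 3
            (HodgeCM.HermSpace3.Hm V))) ∧
      (∀ Φ : (CohFormsCarriers.adelicDatum F V).Adelic → (Fin 2 → ℂ),
        Φ ∈ CohFormsCarriers.cohForms (CohFormsCarriers.archFactorOf F V) →
        Lb Φ ∈ cohForms (↥(maximalRealSubfield (HodgeCM.CMField.K F))) (HodgeCM.CMField.K F) (IsCMField.complexConj (HodgeCM.CMField.K F)) 3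
          (HodgeCM.HermSpace3.Hm V) (cmArchSection (HodgeCM.CMField.K F) ι₁ (HodgeCM.HermSpace3.Hm V) T hT)
          (cmCompactFactor (HodgeCM.CMField.K F) ι₁ (HodgeCM.HermSpace3.Hm V) T hT)) := by
  obtain ⟨a, -, haf, -, -, hhol, hanti, hcoh⟩ := exists_frameTransport_pin F V T hT
  have haf' : ∀ g : ↥(HodgeCM.HermSpace3.adelicFin V), Commute (CohFormsCarriers.finToAdelic F V g) a⁻¹ :=
    fun g => (haf g).inv_right
  refine ⟨LinearMap.funLeft ℂ (Fin 2 → ℂ) fun y => y * a⁻¹,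
    LinearMap.funLeft_injective_of_surjective ℂ (Fin 2 → ℂ) _ (mul_right_surjective a⁻¹), fun g Φ => ?_, fun Φ hΦ => ?_,
    fun Φ hΦ => ?_, fun Φ hΦ => ?_⟩
  · exact rightRep_comp_mul_right haf' g Φ
  · refine (hhol _).mpr ?_
    show (fun y => (fun z => Φ (z * a⁻¹)) (y * a)) ∈ _
    rw [comp_mul_right_cancel_inv]
    exact hΦ
  · refine (hanti _).mpr ?_
    show (fun y => (fun z => Φ (z * a⁻¹)) (y * a)) ∈ _
    rw [comp_mul_right_cancel_inv]
    exact hΦ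
  · refine (hcoh _).mpr ?_
    show (fun y => (fun z => Φ (z * a⁻¹)) (y * a)) ∈ _
    rw [comp_mul_right_cancel_inv]
    exact hΦ

/-! ## §2 Transport of the `∃ θ`-clause along an injective equivariant linear map of the values -/

/-- **Values transport of the occurrence clause** (generic): if `Lb` is an injective linear map on `ℂ²`-valued functions on `U(V)(𝔸_{F⁺})` commuting
with the finite-adelic right translation and carrying `A` into `A′`, then a NON-ZERO `rightRep`-equivariant `θ : W → A` gives the NON-ZERO
`rightRep`-equivariant `Lb ∘ θ : W → A′` — for every representation `σ` of `U(V)(𝔸_{F⁺,f})` on `W`. [cite: BorelJacquet1979, §4.2] -/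
theorem occursClause_map_values {W : Type} [AddCommGroup W] [Module ℂ W]
    (σ : Representation ℂ ↥(HodgeCM.HermSpace3.adelicFin V) W)
    (A A' : Submodule ℂ ((CohFormsCarriers.adelicDatum F V).Adelic → (Fin 2 → ℂ)))
    (Lb : ((CohFormsCarriers.adelicDatum F V).Adelic → (Fin 2 → ℂ)) →ₗ[ℂ] ((CohFormsCarriers.adelicDatum F V).Adelic → (Fin 2 → ℂ)))
    (hinj : Function.Injective Lb)
    (hcomm : ∀ (g : ↥(HodgeCM.HermSpace3.adelicFin V)) (Φ : (CohFormsCarriers.adelicDatum F V).Adelic → (Fin 2 → ℂ)),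
      CohFormsCarriers.rightRep F V g (Lb Φ) = Lb (CohFormsCarriers.rightRep F V g Φ))
    (hAA' : ∀ Φ ∈ A, Lb Φ ∈ A')
    (h : ∃ θ : W →ₗ[ℂ] ((CohFormsCarriers.adelicDatum F V).Adelic → (Fin 2 → ℂ)),
      θ ≠ 0 ∧ (∀ w, θ w ∈ A) ∧
        ∀ (g : ↥(HodgeCM.HermSpace3.adelicFin V)) (w : W), θ (σ g w) = CohFormsCarriers.rightRep F V g (θ w)) :
    ∃ θ : W →ₗ[ℂ] ((CohFormsCarriers.adelicDatum F V).Adelic → (Fin 2 → ℂ)),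
      θ ≠ 0 ∧ (∀ w, θ w ∈ A') ∧
        ∀ (g : ↥(HodgeCM.HermSpace3.adelicFin V)) (w : W), θ (σ g w) = CohFormsCarriers.rightRep F V g (θ w) := by
  obtain ⟨θ, hne, hA, heqv⟩ := h
  refine ⟨Lb ∘ₗ θ, fun h0 => hne ?_, fun w => hAA' _ (hA w), fun g w => ?_⟩
  · refine LinearMap.ext fun w => hinj ?_
    have := congrArg (fun f : W →ₗ[ℂ] _ => f w) h0
    simpa only [LinearMap.coe_comp, Function.comp_apply, LinearMap.zero_apply, map_zero] using this
  · simp only [LinearMap.coe_comp, Function.comp_apply, heqv, hcomm]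

/-! ## §3 The engine's values (`holCotForms (archFactorOf F V)`) in the letter's currency (`holCotForms [T]` ∕ `cohForms [T]`) -/

/-- **(Ta) ON THE `∃ θ`-CLAUSE, holomorphic values.**  For every representation `σ` of `U(V)(𝔸_{F⁺,f})`: an occurrence with values in
`holCotForms (archFactorOf F V)` (★ `exists_holTheta_atLine_of_inputs`'s currency, equivariance `θ (σ g w) = rightRep F V g (θ w)`) gives an occurrence with
values in `holCotForms [cmArchSection T, cmCompactFactor T]` for every Sylvester frame `T` of `Hm V` at `ι₁`, with the letter's spelling of equivariance
`θ (σ g w) = fun x ↦ θ w (x * finAdelicToAdelic … g)` (definitionally the same). [cite: BorelJacquet1979, §4.1, §4.2] [cite: BorelWallach2000, VII 2.10] -/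
theorem occursClause_holCotForms_frame_of_archFactorOf {W : Type} [AddCommGroup W] [Module ℂ W]
    (σ : Representation ℂ ↥(HodgeCM.HermSpace3.adelicFin V) W)
    (h : ∃ θ : W →ₗ[ℂ] ((CohFormsCarriers.adelicDatum F V).Adelic → (Fin 2 → ℂ)),
      θ ≠ 0 ∧ (∀ w, θ w ∈ CohFormsCarriers.holCotForms (CohFormsCarriers.archFactorOf F V)) ∧
        ∀ (g : ↥(HodgeCM.HermSpace3.adelicFin V)) (w : W), θ (σ g w) = CohFormsCarriers.rightRep F V g (θ w)) :
    ∃ θ : W →ₗ[ℂ] ((CohFormsCarriers.adelicDatum F V).Adelic → (Fin 2 → ℂ)),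
      θ ≠ 0 ∧
        (∀ w, θ w ∈ holCotForms (↥(maximalRealSubfield (HodgeCM.CMField.K F))) (HodgeCM.CMField.K F) (IsCMField.complexConj (HodgeCM.CMField.K F)) 3
          (HodgeCM.HermSpace3.Hm V) (cmArchSection (HodgeCM.CMField.K F) ι₁ (HodgeCM.HermSpace3.Hm V) T hT)
          (cmCompactFactor (HodgeCM.CMField.K F) ι₁ (HodgeCM.HermSpace3.Hm V) T hT)) ∧
        ∀ (g : ↥(HodgeCM.HermSpace3.adelicFin V)) (w : W),
          θ (σ g w) = fun x => θ w (x * CohFormsCarriers.finToAdelic F V g) := by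
  obtain ⟨Lb, hinj, hcomm, hhol, -, -⟩ := exists_linear_frameTransport_from_pin F V T hT
  exact occursClause_map_values F V σ _ _ Lb hinj hcomm hhol h

/-- **(Ta) ON THE `∃ θ`-CLAUSE, cohomological values — the letter's currency.**  For every representation `σ` of `U(V)(𝔸_{F⁺,f})`: an occurrence with
values in `holCotForms (archFactorOf F V)` gives, for every Sylvester frame `T` of `Hm V` at `ι₁`, an occurrence with values in
`cohForms [cmArchSection T, cmCompactFactor T]` — the value clause of `StubThetaOccursInGen` — with equivariance `θ (σ g w) = fun x ↦ θ w (x * k_𝔸)`.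
[cite: BorelJacquet1979, §4.1, §4.2] [cite: BorelWallach2000, VII 2.10] [cite: Liu2021, Prop. 4.13 («Conversely» l. 2145–2149)] -/
theorem occursClause_cohForms_frame_of_archFactorOf {W : Type} [AddCommGroup W] [Module ℂ W]
    (σ : Representation ℂ ↥(HodgeCM.HermSpace3.adelicFin V) W)
    (h : ∃ θ : W →ₗ[ℂ] ((CohFormsCarriers.adelicDatum F V).Adelic → (Fin 2 → ℂ)),
      θ ≠ 0 ∧ (∀ w, θ w ∈ CohFormsCarriers.holCotForms (CohFormsCarriers.archFactorOf F V)) ∧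
        ∀ (g : ↥(HodgeCM.HermSpace3.adelicFin V)) (w : W), θ (σ g w) = CohFormsCarriers.rightRep F V g (θ w)) :
    ∃ θ : W →ₗ[ℂ] ((CohFormsCarriers.adelicDatum F V).Adelic → (Fin 2 → ℂ)),
      θ ≠ 0 ∧
        (∀ w, θ w ∈ cohForms (↥(maximalRealSubfield (HodgeCM.CMField.K F))) (HodgeCM.CMField.K F) (IsCMField.complexConj (HodgeCM.CMField.K F)) 3
          (HodgeCM.HermSpace3.Hm V) (cmArchSection (HodgeCM.CMField.K F) ι₁ (HodgeCM.HermSpace3.Hm V) T hT)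
          (cmCompactFactor (HodgeCM.CMField.K F) ι₁ (HodgeCM.HermSpace3.Hm V) T hT)) ∧
        ∀ (g : ↥(HodgeCM.HermSpace3.adelicFin V)) (w : W),
          θ (σ g w) = fun x => θ w (x * CohFormsCarriers.finToAdelic F V g) := by
  obtain ⟨Lb, hinj, hcomm, -, -, hcoh⟩ := exists_linear_frameTransport_from_pin F V T hT
  exact occursClause_map_values F V σ _ _ Lb hinj hcomm
    (fun Φ hΦ => hcoh Φ (CohFormsCarriers.holCotForms_le_cohForms _ hΦ)) h

end Summit.HodgeConjecture.HodgeConjecture.Cruxes.H413.F0P2sThetaOccursInArchTransport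

end
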